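import Mathlib
import Literature.Analysis.ODE.GalerkinProjectionLp
import Literature.Analysis.FunctionSpaces.LatticePairing
import Literature.Analysis.FunctionSpaces.LatticeSobolevSmooth
import HarnessLib

/-!
# The lattice `ℓ²` phase space: Mathlib's `lp` over `ℤ^d`, cube truncations, and the dictionary to the `Lattice*` toolkit (instab g16, cell `ns-blowup`, 2026-08-27)

HONEST FRAMING (human ruling D-0035): nothing here is a claim about Navier–Stokes blow-up.
WHAT THIS IS NOT: not NS evidence — bookkeeping identities between Mathlib's `lp (fun _ : ℤ^d => V) 2`
and the tree's lattice Sobolev vocabulary (`Lattice.pairing`, `Lattice.eNormSq`, `Lattice.trunc`),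
plus the structural properties of the CUBE truncations. No flow, set `W`, operator or certificate
is constructed; `0` definitions (the cube is written out as `Fintype.piFinset`).

PURPOSE (`HOME/instab/BETA2-SPEC.md` §1, «(β2-ii) plumbing»). The R-β chain is stated on an
abstract real inner-product space with symmetric idempotent nested truncations `P n`
(`GalerkinOneSidedLipschitz.galerkin_oneSided_uniform_transport_of_truncated`,
`GalerkinEmergenceCertificate`); the model instance takes `E :=` the `H²`-SCALED `ℓ²` of Fourier
coefficients, i.e. Mathlib's `lp (fun _ : (d → ℤ) => V) 2` holding the scaled family `c = Λ² û`
(`Lattice.wmul 2`), and `P n :=` the coordinate projection onto the cube `|k|_∞ ≤ n`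
(`Literature.Analysis.ODE.lpProj`, [WilczakZgliczynski2025] §2/§4). This file records:

* §1 `inner_eq_pairing` — the `ℓ²` inner product IS the lattice pairing `∑_k ⟪f k, g k⟫`;
  `eNormSq_zero_coe_lt_top`, `memℓp_two_iff_eNormSq_zero_lt_top` — membership in `ℓ²` is
  `Lattice.eNormSq 0 < ∞`; `norm_sq_eq_toReal_eNormSq_zero` — `‖f‖² = (eNormSq 0 f).toReal`
  (so with `f = Λ² û`: `‖f‖² = ‖û‖₂²`, `Lattice.eNormSq_wmul`).
* §2 `coe_lpProj_eq_trunc` — the coordinate projection is the tree's truncation `𝟙_s`;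
  `inner_lpProj_left_eq_right` — `P_s` is symmetric for the `ℓ²` inner product; with
  `lpProj_idem`, `lpProj_lpProj_of_subset` (tree) these are the hypotheses `hPsymm`/`hPidem`.
* §3 the cubes `cube n = {k : ∀ i, |k i| ≤ n}` (as `Fintype.piFinset fun _ => Finset.Icc (-n) n`):
  `cube_mono`, `mem_cube_of_le` (exhaustion), `lpProj_cube_nested_le/ge` (the two nesting
  identities `P_n P_m = P_m P_n = P_min`), `tendsto_lpProj_cube` (`P_n f → f`, from the tree's
  `tendsto_lpProj_atTop` and cofinality of the cubes).

The REAL inner product on `E` needed by the abstract chain is `InnerProductSpace.complexToReal`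
(a `def` in Mathlib, to be installed with `letI` in the assembly file; its norm is `E`'s norm and
`⟪f, g⟫_ℝ = Re ⟪f, g⟫_ℂ = Re (Lattice.pairing f g)`, Mathlib `real_inner_eq_re_inner`) — not done
here to keep this file instance-free.
-/

noncomputable section

namespace Summit.NavierStokesRegularity.FluidComputer.GalerkinLatticePhaseSpace

open Finset Filter Topology
open Literature.Analysis.FunctionSpaces Literature.Analysis.FunctionSpaces.Lattice
open Literature.Analysis.FunctionSpaces.Torus Literature.Analysis.ODE
open scoped ENNReal NNReal InnerProductSpace

variable {d : Type*} [Fintype d]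
variable {V : Type*} [NormedAddCommGroup V] [InnerProductSpace ℂ V] [CompleteSpace V]

/-! ## §1 The `ℓ²` inner product and norm in the lattice vocabulary -/

omit [Fintype d] [CompleteSpace V] in
/-- **The `ℓ²` inner product is the lattice pairing**: `⟪f, g⟫ = ∑_k ⟪f k, g k⟫ = Lattice.pairing f g`. -/
theorem inner_eq_pairing (f g : lp (fun _ : (d → ℤ) => V) 2) :
    ⟪f, g⟫_ℂ = pairing (⇑f) (⇑g) := by
  rw [lp.inner_eq_tsum]; rfl

omit [InnerProductSpace ℂ V] [CompleteSpace V] in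
/-- Membership in `ℓ²` is finiteness of the lattice `H⁰` norm. -/
theorem memℓp_two_iff_eNormSq_zero_lt_top (c : (d → ℤ) → V) :
    Memℓp c 2 ↔ eNormSq 0 c < ∞ := by
  have h2 : (0 : ℝ≥0∞) < 2 := by norm_num
  rw [memℓp_gen_iff (by norm_num : 0 < (2 : ℝ≥0∞).toReal)]
  have hcongr : (fun k => ‖c k‖ ^ (2 : ℝ≥0∞).toReal) = fun k => sobolevWeight 0 k ^ 2 * ‖c k‖ ^ 2 := by
    funext k
    rw [sobolevWeight_zero, one_pow, one_mul, show (2 : ℝ≥0∞).toReal = ((2 : ℕ) : ℝ) by norm_num,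
      Real.rpow_natCast]
  rw [hcongr]
  exact ⟨eNormSq_lt_top_of_summable, summable_of_eNormSq_lt_top⟩

omit [InnerProductSpace ℂ V] [CompleteSpace V] in
/-- An `ℓ²` element has finite lattice `H⁰` norm. -/
theorem eNormSq_zero_coe_lt_top (f : lp (fun _ : (d → ℤ) => V) 2) : eNormSq 0 (⇑f) < ∞ :=
  (memℓp_two_iff_eNormSq_zero_lt_top _).1 f.2

omit [Fintype d] [InnerProductSpace ℂ V] [CompleteSpace V] in
/-- **The `ℓ²` norm is the lattice `H⁰` norm**: `‖f‖² = (eNormSq 0 f).toReal` (so for the scaled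
family `f = Λ² û`, `‖f‖² = ‖û‖₂²` by `Lattice.eNormSq_wmul`). -/
theorem norm_sq_eq_toReal_eNormSq_zero [Fintype d] (f : lp (fun _ : (d → ℤ) => V) 2) :
    ‖f‖ ^ 2 = (eNormSq 0 (⇑f)).toReal := by
  have key : ‖f‖ ^ (2 : ℝ) = ∑' k, ‖f k‖ ^ (2 : ℝ) := by
    have h := lp.norm_rpow_eq_tsum (by norm_num : 0 < (2 : ℝ≥0∞).toReal) f
    rw [show (2 : ℝ≥0∞).toReal = (2 : ℝ) by norm_num] at h
    exact h
  rw [eNormSq, ENNReal.tsum_toReal_eq fun k => ENNReal.mul_ne_top ENNReal.ofReal_ne_top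
    (ENNReal.pow_ne_top enorm_ne_top), ← Real.rpow_natCast, Nat.cast_ofNat, key]
  refine tsum_congr fun k => ?_
  rw [toReal_term, sobolevWeight_zero, one_pow, one_mul, ← Real.rpow_natCast, Nat.cast_ofNat]

/-! ## §2 Coordinate projections = truncations; symmetry -/

omit [InnerProductSpace ℂ V] [CompleteSpace V] in
/-- **The coordinate projection is the lattice truncation**: `⇑(P_s f) = 𝟙_s ⇑f`. -/
theorem coe_lpProj_eq_trunc [NormedSpace ℂ V] (s : Finset (d → ℤ)) (f : lp (fun _ : (d → ℤ) => V) 2) :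
    ⇑(lpProj (fun _ : (d → ℤ) => V) 2 s f) = trunc s (⇑f) := by
  funext k
  rw [lpProj_coe_apply, trunc_apply]

omit [Fintype d] [CompleteSpace V] in
/-- **`P_s` is symmetric** for the `ℓ²` inner product: `⟪P_s f, g⟫ = ⟪f, P_s g⟫` (both equal
`∑_{k ∈ s} ⟪f k, g k⟫`). -/
theorem inner_lpProj_left_eq_right [Fintype d] (s : Finset (d → ℤ)) (f g : lp (fun _ : (d → ℤ) => V) 2) :
    ⟪lpProj (fun _ : (d → ℤ) => V) 2 s f, g⟫_ℂ = ⟪f, lpProj (fun _ : (d → ℤ) => V) 2 s g⟫_ℂ := by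
  rw [lp.inner_eq_tsum, lp.inner_eq_tsum]
  refine tsum_congr fun k => ?_
  rw [lpProj_coe_apply, lpProj_coe_apply]
  by_cases hk : k ∈ s <;> simp [hk]

/-! ## §3 The cubes `|k|_∞ ≤ n` -/

section Cube

variable [DecidableEq d]

omit [Fintype d] in
/-- Monotonicity of the symmetric integer intervals. -/
theorem Icc_neg_subset {n m : ℕ} (h : n ≤ m) : Finset.Icc (-(n : ℤ)) n ⊆ Finset.Icc (-(m : ℤ)) m := by
  intro x hx
  rw [Finset.mem_Icc] at hx ⊢
  constructor <;> omega

/-- **The cubes are nested**: `cube n ⊆ cube m` for `n ≤ m`. -/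
theorem cube_mono {n m : ℕ} (h : n ≤ m) :
    Fintype.piFinset (fun _ : d => Finset.Icc (-(n : ℤ)) n) ⊆
      Fintype.piFinset (fun _ : d => Finset.Icc (-(m : ℤ)) m) :=
  Fintype.piFinset_subset _ _ fun _ => Icc_neg_subset h

/-- **The cubes exhaust `ℤ^d`**: every `k` lies in the cube of radius `∑_i |k i|` (a crude but
monotone choice). -/
theorem mem_cube_of_le (k : d → ℤ) {n : ℕ} (hn : ∀ i, |k i| ≤ n) :
    k ∈ Fintype.piFinset (fun _ : d => Finset.Icc (-(n : ℤ)) n) := by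
  rw [Fintype.mem_piFinset]
  intro i
  rw [Finset.mem_Icc]
  have := hn i
  constructor <;> linarith [abs_le.1 this]

/-- Every finite set of modes lies in some cube. -/
theorem exists_subset_cube (s : Finset (d → ℤ)) :
    ∃ n : ℕ, s ⊆ Fintype.piFinset (fun _ : d => Finset.Icc (-(n : ℤ)) n) := by
  classical
  refine ⟨s.sup fun k => ∑ i, (k i).natAbs, fun k hk => mem_cube_of_le k fun i => ?_⟩
  have h1 : ((k i).natAbs : ℤ) ≤ ((∑ j, (k j).natAbs : ℕ) : ℤ) := by
    have : (k i).natAbs ≤ ∑ j, (k j).natAbs :=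
      Finset.single_le_sum (f := fun j => (k j).natAbs) (fun j _ => Nat.zero_le _) (Finset.mem_univ i)
    exact_mod_cast this
  have h2 : ((∑ j, (k j).natAbs : ℕ) : ℤ) ≤ ((s.sup fun k => ∑ i, (k i).natAbs : ℕ) : ℤ) := by
    exact_mod_cast Finset.le_sup (f := fun k => ∑ i, (k i).natAbs) hk
  rw [← Int.natCast_natAbs]
  exact h1.trans h2

variable [NormedSpace ℂ V]

omit [InnerProductSpace ℂ V] [CompleteSpace V] in
/-- Nesting, first identity: `P_n (P_m f) = P_n f` for `n ≤ m`. -/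
theorem lpProj_cube_nested_le {n m : ℕ} (h : n ≤ m) (f : lp (fun _ : (d → ℤ) => V) 2) :
    lpProj (fun _ : (d → ℤ) => V) 2 (Fintype.piFinset fun _ : d => Finset.Icc (-(n : ℤ)) n)
      (lpProj (fun _ : (d → ℤ) => V) 2 (Fintype.piFinset fun _ : d => Finset.Icc (-(m : ℤ)) m) f) =
    lpProj (fun _ : (d → ℤ) => V) 2 (Fintype.piFinset fun _ : d => Finset.Icc (-(n : ℤ)) n) f :=
  lpProj_lpProj_of_subset (cube_mono h) f

omit [InnerProductSpace ℂ V] [CompleteSpace V] in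
/-- Nesting, second identity: `P_m (P_n f) = P_n f` for `n ≤ m`. -/
theorem lpProj_cube_nested_ge {n m : ℕ} (h : n ≤ m) (f : lp (fun _ : (d → ℤ) => V) 2) :
    lpProj (fun _ : (d → ℤ) => V) 2 (Fintype.piFinset fun _ : d => Finset.Icc (-(m : ℤ)) m)
      (lpProj (fun _ : (d → ℤ) => V) 2 (Fintype.piFinset fun _ : d => Finset.Icc (-(n : ℤ)) n) f) =
    lpProj (fun _ : (d → ℤ) => V) 2 (Fintype.piFinset fun _ : d => Finset.Icc (-(n : ℤ)) n) f := by
  rw [lpProj_lpProj, Finset.inter_eq_right.2 (cube_mono h)]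

omit [InnerProductSpace ℂ V] [CompleteSpace V] in
/-- **The cube truncations converge strongly**: `P_{cube n} f → f` in `ℓ²` (cofinality of the cubes
in the tree's `tendsto_lpProj_atTop`). -/
theorem tendsto_lpProj_cube (f : lp (fun _ : (d → ℤ) => V) 2) :
    Tendsto (fun n : ℕ => lpProj (fun _ : (d → ℤ) => V) 2
      (Fintype.piFinset fun _ : d => Finset.Icc (-(n : ℤ)) n) f) atTop (𝓝 f) := by
  refine (tendsto_lpProj_atTop (by norm_num) f).comp ?_
  refine Monotone.tendsto_atTop_atTop (fun n m h => cube_mono h) fun s => ?_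
  exact exists_subset_cube s

end Cube

end Summit.NavierStokesRegularity.FluidComputer.GalerkinLatticePhaseSpace

end
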